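import Literature.NumberTheory.LFunctions.ZetaScrewThm17Proofs
import HarnessLib

/-!
# RH ⇔ the non-archimedean part of Suzuki's screw function is eventually non-negative (Suzuki 2025)

Topic `Literature/NumberTheory/LFunctions`; sibling of `ZetaScrew.lean` (`zetaScrew = Ψ = −g_ζ`,
`zetaScrewPrimeSum = φ`) and `ZetaScrewThm17Proofs.lean` (Suzuki 2023, Thm 1.7: RH ⇔ `Ψ ≥ 0`).
Source:

> M. Suzuki, *On variants of Chebyshev's conjecture*, Ramanujan J. **68** (2025), no. 4 =
> arXiv:2411.07436 [Suzuki2025Chebyshev], §1.1, Theorem 1 and Corollary 1, with the proofs of §3.1–3.2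
> (Prop. 1 of §2 = Landau's theorem for Laplace transforms of non-negative functions, [Wi41]).

AS PRINTED (§1.1). With `ψ_{1/2}(x) = Σ_{n ≤ x} Λ(n) n^{-1/2}` and the screw function
`g_ζ = -Ψ` of [Su23] split as `g_ζ = g_0 + g_∞` ((1.7)):
`g_0(t) := Σ_{n ≤ e^{|t|}} Λ(n) n^{-1/2} (|t| − log n) − 4(e^{t/2} + e^{−t/2} − 2)`,
`g_∞(t) := −(|t|/2)((Γ'/Γ)(1/4) − log π) − ¼(Φ(1,2,1/4) − e^{−|t|/2} Φ(e^{−2|t|},2,1/4))`,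
so that ((1.9)) `g_0(log x) = Σ_{n ≤ x} Λ(n) n^{-1/2} log(x/n) − 4(√x + 1/√x − 2)`:

* **Theorem 1.** «The following three statements are equivalent: (i) The RH holds. (ii) There exists
  an `x₀ ≥ 2` such that `∫_0^x (ψ_{1/2}(y) − 2√y) dy/y = Σ_{n ≤ x} Λ(n) n^{-1/2} log(x/n) − 4√x ≤ 0`
  holds for all `x ≥ x₀`. (iii) It holds that
  `lim_{x→∞} [Σ_{n ≤ x} Λ(n) n^{-1/2} (1 − log n/log x) − 4√x/log x] = −(ζ'/ζ)(1/2)`.»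
* **Corollary 1.** «Let `g_0(t)` be the non-archimedean part of `g_ζ(t)` defined in (1.7). Then, the
  RH holds if and only if there exists `t_0 > 0` such that `−g_0(t) ≥ 0` holds for all `t ≥ t_0`.»

## What is here (everything PROVED; no named facts)

* `zetaScrewNonArch t = 4(e^{|t|/2} + e^{−|t|/2} − 2) − zetaScrewPrimeSum t` — the function `−g_0`
  of (1.7) (even in `t`, like the tree's `Ψ`; `zetaScrewNonArch_eq` removes the `|·|` in the
  exponentials, `zetaScrewNonArch_log` is (1.9));
* `zetaScrew_eq_zetaScrewNonArch_sub_add` (`Ψ = −g_0 − g_∞` in the tree's normalisation of (1.1) of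
  [Su23]) and the RH-FREE comparison `zetaScrew_add_sub_le_zetaScrewNonArch`:
  `Ψ(t) + (|t|/2)κ − C/4 ≤ −g_0(t)`, `κ = γ + π/2 + 3 log 2 + log π = −((Γ'/Γ)(1/4) − log π) > 0`,
  `C = Σ_{k ≥ 0} (k + 1/4)^{-2} = Φ(1,2,1/4)`;
* `Suzuki2025_cor1 : RiemannHypothesis ↔ ∃ t₀ > 0, ∀ t ≥ t₀, 0 ≤ zetaScrewNonArch t` (Corollary 1);
* `Suzuki2025_thm1 : RiemannHypothesis ↔ ∃ x₀ ≥ 2, ∀ x ≥ x₀, Σ_{n ≤ x} Λ(n) n^{-1/2} log(x/n) − 4√x ≤ 0`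
  (Theorem 1, (i) ⇔ (ii), the sum written over `1 ≤ n ≤ ⌊x⌋`);
* `logDeriv_riemannZeta_one_half` ((3.2): `(ζ'/ζ)(1/2) = ½(γ + π/2 + 3 log 2 + log π) > 0`) and
  `Suzuki2025_thm1_iii_imp` (Theorem 1, (iii) ⇒ (i)).

## The proofs (§3.1–3.2 of the paper, on top of the tree)

«(ii)/(−g_0 ≥ 0 eventually) ⇒ RH» exactly as printed: the Laplace transforms
`∫_0^∞ (−g_0(t)) e^{−tS} dt = S^{-2}((ζ'/ζ)(1/2+S) + 1/(S−1/2) + 1/(S+1/2))` ((3.5), `S = s − 1/2`) and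
`∫_0^∞ (4e^{t/2} − φ(t)) e^{−tS} dt = S^{-2}(ζ'/ζ)(1/2+S) + 4/(S−1/2)` ((3.4)) are assembled from the
tree's termwise transforms (`ZetaScrewLaplace.integral_primeSum_mul_cexp`, `…integral_exp_half_mul_cexp`),
the pole at `S = 1/2` is cancelled by writing `(ζ'/ζ)(w) + 1/(w−1) = (ζ₁'/ζ₁)(w)` with Mathlib's entire
`riemannZeta₁ = (s−1)ζ(s)`, and Landau's theorem (the tree's
`Landau.integrableOn_of_differentiableOn_union_convex`, Montgomery–Vaughan Lemma 15.1, for EVENTUALLY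
non-negative integrands) plus the order-of-vanishing argument of `ZetaScrewThm17Proofs` give
`ζ(w) ≠ 0` for `1/2 < Re w < 1`, i.e. RH (`quasiRiemannHypothesis_one_half_iff_holds`). Both cases run
through ONE lemma, `ZetaScrewNonArchSign.riemannHypothesis_of_laplace_eq` (transform
`= (ζ₁'/ζ₁(1/2+S) + P(S))/S²` with `P` holomorphic on `Re S > 0`).
«RH ⇒ (ii)/(−g_0 ≥ 0 eventually)»: the paper uses the explicit formula (3.1) for `ψ_{1/2}`; here the
shorter road through the tree is taken instead — under RH `Ψ ≥ 0` (Suzuki 2023 Thm 1.7,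
`ZetaScrewThm17.zetaScrew_nonneg_of_RH`, proved in the tree), and `−g_0 = Ψ + (|t|/2)κ − ¼(C − e^{−|t|/2}Φ_t) ≥ (|t|/2)κ − C/4`.

## Deliberately NOT here

«(i) ⇒ (iii)» of Theorem 1 (the limit `= −(ζ'/ζ)(1/2) = −2.68609…`): it needs the explicit formula
(3.1) for `Σ_{n ≤ x} Λ(n) n^{-1/2} log(x/n)` ([So09]) with its sum over the zeros bounded under RH,
which the tree does not have at `s = 1/2` (only «(iii) ⇒ (i)» is here); the integral form `∫_0^x (ψ_{1/2}(y) − 2√y) dy/y` of the left-hand side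
of (1.5) (an antiderivative identity); Theorems 2–7 (the `ψ_{1/2} − 2Σ` variant and Dirichlet
`L`-functions / Chebyshev's bias). RH-EQUIVALENT criterion: nothing here is progress towards RH.

## References

* [Suzuki2025Chebyshev] M. Suzuki, Ramanujan J. 68 (2025) no. 4, doi:10.1007/s11139-025-01238-9 =
  arXiv:2411.07436: §1.1 (1.5)–(1.9), Thm 1, Cor 1; §2 Prop 1; §3.1–3.2 (3.3)–(3.5).
* [Suzuki2023] M. Suzuki, J. Lond. Math. Soc. (2) 108 (2023) 1448–1487, (1.1), Thm 1.7 (the tree's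
  `ZetaScrew*.lean`).
* [Widder1941] D. V. Widder, *The Laplace Transform*, Ch. II §5 Thm 5b; [MontgomeryVaughan2007]
  Lemma 15.1 (the tree's `LandauOscillation.lean`).
-/

noncomputable section

open Complex Filter Topology Set MeasureTheory
open scoped Real LSeries.notation ArithmeticFunction.vonMangoldt

namespace Literature.NumberTheory.LFunctions

/-! ## The non-archimedean part `−g₀` of the screw function -/

/-- **`−g_0(t)`**, the negative of the non-archimedean part of Suzuki's screw function `g_ζ = −Ψ`
((1.7) of [Suzuki2025Chebyshev], extended evenly like the tree's `zetaScrew`):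
`−g_0(t) = 4(e^{|t|/2} + e^{−|t|/2} − 2) − Σ_{1 ≤ n ≤ e^{|t|}} Λ(n) n^{-1/2} (|t| − log n)`
`= 4(e^{|t|/2} + e^{−|t|/2} − 2) − zetaScrewPrimeSum t`. It «corresponds to the non-archimedean factor
`s(s−1)ζ(s)`» of `ξ` (p. 3). [cite: Suzuki2025Chebyshev, §1.1 eq. (1.7)] -/
def zetaScrewNonArch (t : ℝ) : ℝ :=
  4 * (Real.exp (|t| / 2) + Real.exp (-(|t| / 2)) - 2) - zetaScrewPrimeSum t

/-- (1.7) verbatim: the exponential part may be written without `|·|` (it is even).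
[cite: Suzuki2025Chebyshev, §1.1 eq. (1.7)] -/
theorem zetaScrewNonArch_eq (t : ℝ) :
    zetaScrewNonArch t = 4 * (Real.exp (t / 2) + Real.exp (-(t / 2)) - 2) - zetaScrewPrimeSum t := by
  unfold zetaScrewNonArch
  rcases le_or_gt 0 t with ht | ht
  · rw [abs_of_nonneg ht]
  · rw [abs_of_neg ht, show -t / 2 = -(t / 2) by ring, neg_neg, add_comm (Real.exp (-(t / 2)))]

/-- `−g_0` is even (it is (1.7) in the variable `|t|`). [cite: Suzuki2025Chebyshev, §1.1 eq. (1.7)] -/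
@[simp] theorem zetaScrewNonArch_neg (t : ℝ) : zetaScrewNonArch (-t) = zetaScrewNonArch t := by
  simp only [zetaScrewNonArch, abs_neg, zetaScrewPrimeSum_neg]

/-- `−g_0(|t|) = −g_0(t)` ((1.7) depends on `t` through `|t|`). [cite: Suzuki2025Chebyshev, §1.1 eq. (1.7)] -/
@[simp] theorem zetaScrewNonArch_abs (t : ℝ) : zetaScrewNonArch |t| = zetaScrewNonArch t := by
  rcases le_or_gt 0 t with ht | ht
  · rw [abs_of_nonneg ht]
  · rw [abs_of_neg ht, zetaScrewNonArch_neg]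

/-- `−g_0` of (1.7) is continuous (a finite prime sum of continuous functions plus exponentials).
[cite: Suzuki2025Chebyshev, §1.1 eq. (1.7)] -/
theorem continuous_zetaScrewNonArch : Continuous zetaScrewNonArch := by
  have h1 : Continuous fun t : ℝ ↦ Real.exp (|t| / 2) :=
    Real.continuous_exp.comp (continuous_abs.div_const _)
  have h2 : Continuous fun t : ℝ ↦ Real.exp (-(|t| / 2)) :=
    Real.continuous_exp.comp (continuous_abs.div_const _).neg
  unfold zetaScrewNonArch
  exact (continuous_const.mul ((h1.add h2).sub continuous_const)).sub continuous_zetaScrewPrimeSum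

/-- For `x ≥ 1`, the prime sum at `t = log x` is `Σ_{1 ≤ n ≤ ⌊x⌋} Λ(n) n^{-1/2} log(x/n)`.
[cite: Suzuki2025Chebyshev, §1.1 eq. (1.9)] -/
theorem zetaScrewPrimeSum_log {x : ℝ} (hx : 1 ≤ x) :
    zetaScrewPrimeSum (Real.log x) =
      ∑ n ∈ Finset.Icc 1 ⌊x⌋₊, Λ n / Real.sqrt n * Real.log (x / n) := by
  have hx0 : 0 < x := by linarith
  unfold zetaScrewPrimeSum
  rw [abs_of_nonneg (Real.log_nonneg hx), Real.exp_log hx0]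
  refine Finset.sum_congr rfl fun n hn ↦ ?_
  have hn1 : 1 ≤ n := (Finset.mem_Icc.1 hn).1
  rw [Real.log_div hx0.ne' (by exact_mod_cast (show n ≠ 0 by omega))]

/-- **(1.9)**: `−g_0(log x) = 4(√x + 1/√x − 2) − Σ_{n ≤ x} Λ(n) n^{-1/2} log(x/n)` for `x ≥ 1`.
[cite: Suzuki2025Chebyshev, §1.1 eq. (1.9)] -/
theorem zetaScrewNonArch_log {x : ℝ} (hx : 1 ≤ x) :
    zetaScrewNonArch (Real.log x) =
      4 * (Real.sqrt x + 1 / Real.sqrt x - 2) -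
        ∑ n ∈ Finset.Icc 1 ⌊x⌋₊, Λ n / Real.sqrt n * Real.log (x / n) := by
  have hx0 : 0 < x := by linarith
  rw [zetaScrewNonArch_eq, zetaScrewPrimeSum_log hx, Real.exp_neg, Real.exp_half, Real.exp_log hx0,
    one_div]

/-- `Ψ = −g_0 − g_∞` in the normalisation of (1.1) of [Suzuki2023] used by the tree's `zetaScrew`:
`Ψ(t) = −g_0(t) − (|t|/2)κ + ¼(C − e^{−|t|/2} Φ(e^{−2|t|},2,1/4))` with
`κ = γ + π/2 + 3 log 2 + log π` (`= −((Γ'/Γ)(1/4) − log π)`) and `C = Σ_{k ≥ 0} (k + 1/4)^{-2}`.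
[cite: Suzuki2025Chebyshev, §1.1 eq. (1.7)] -/
theorem zetaScrew_eq_zetaScrewNonArch_sub_add (t : ℝ) :
    zetaScrew t = zetaScrewNonArch t
      - |t| / 2 * (Real.eulerMascheroniConstant + Real.pi / 2 + 3 * Real.log 2 + Real.log Real.pi)
      + (1 / 4) * ((∑' k : ℕ, 1 / ((k : ℝ) + 1 / 4) ^ 2)
          - Real.exp (-(|t| / 2)) * hurwitzLerchQuarter t) := by
  rw [zetaScrew_eq, zetaScrewNonArch]

/-- `κ = γ + π/2 + 3 log 2 + log π > 0`; as printed (§3.1): `(Γ'/Γ)(1/4) = −π/2 − 3 log 2 − C₀ = −4.22745… < 0`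
(and `log π > 0`). [cite: Suzuki2025Chebyshev, §3.1 (proof of Thm 1)] -/
theorem screwKappa_pos :
    0 < Real.eulerMascheroniConstant + Real.pi / 2 + 3 * Real.log 2 + Real.log Real.pi := by
  have h1 : 0 < Real.eulerMascheroniConstant :=
    lt_trans (by norm_num) Real.one_half_lt_eulerMascheroniConstant
  have h2 : 0 < Real.log 2 := Real.log_pos one_lt_two
  have h3 : 0 < Real.log Real.pi := Real.log_pos (by linarith [Real.pi_gt_three])
  positivity

/-- `C = Σ_{k ≥ 0} (k + 1/4)^{-2} ≥ 0`. [folklore] -/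
private theorem screwC_nonneg : 0 ≤ ∑' k : ℕ, 1 / ((k : ℝ) + 1 / 4) ^ 2 :=
  tsum_nonneg fun k ↦ by positivity

/-- **RH-FREE comparison of `Ψ` and `−g_0`**: `Ψ(t) + (|t|/2)κ − C/4 ≤ −g_0(t)` for every real `t`
(the archimedean part `g_∞` is `−(|t|/2)κ + ¼(C − e^{−|t|/2}Φ_t)` with `0 ≤ e^{−|t|/2}Φ_t`).
[cite: Suzuki2025Chebyshev, §1.1 eq. (1.7)] -/
theorem zetaScrew_add_sub_le_zetaScrewNonArch (t : ℝ) :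
    zetaScrew t
        + |t| / 2 * (Real.eulerMascheroniConstant + Real.pi / 2 + 3 * Real.log 2 + Real.log Real.pi)
        - (1 / 4) * (∑' k : ℕ, 1 / ((k : ℝ) + 1 / 4) ^ 2) ≤ zetaScrewNonArch t := by
  rw [zetaScrew_eq_zetaScrewNonArch_sub_add]
  have h : 0 ≤ Real.exp (-(|t| / 2)) * hurwitzLerchQuarter t :=
    mul_nonneg (Real.exp_pos _).le (hurwitzLerchQuarter_nonneg t)
  linarith

/-- **RH ⇒ `−g_0(t) ≥ 0` for `|t| ≥ C/(2κ)`** (via `Ψ ≥ 0` under RH, Suzuki 2023 Thm 1.7, and the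
RH-free comparison; the paper argues through the explicit formula (3.1) instead).
[cite: Suzuki2025Chebyshev, Cor 1] -/
theorem zetaScrewNonArch_nonneg_of_RH (hRH : RiemannHypothesis) {t : ℝ}
    (ht : (∑' k : ℕ, 1 / ((k : ℝ) + 1 / 4) ^ 2) /
        (2 * (Real.eulerMascheroniConstant + Real.pi / 2 + 3 * Real.log 2 + Real.log Real.pi)) ≤ |t|) :
    0 ≤ zetaScrewNonArch t := by
  have h1 := zetaScrew_add_sub_le_zetaScrewNonArch t
  have h2 := ZetaScrewThm17.zetaScrew_nonneg_of_RH hRH t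
  have hκ := screwKappa_pos
  set κ := Real.eulerMascheroniConstant + Real.pi / 2 + 3 * Real.log 2 + Real.log Real.pi
  set C := ∑' k : ℕ, 1 / ((k : ℝ) + 1 / 4) ^ 2
  have h3 : C ≤ |t| * (2 * κ) := (div_le_iff₀ (by positivity)).1 ht
  nlinarith

/-! ## Landau's theorem for transforms of the shape `(ζ₁'/ζ₁(1/2+S) + P(S))/S²` -/

namespace ZetaScrewNonArchSign

open ZetaScrewLandau

/-- `∫_1^∞ G(log x) x^{-(s+1)} dx = ∫_0^∞ G(t) e^{-st} dt` (substitution `x = e^t`). [folklore] -/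
private theorem mellinIoi_comp_log (G : ℝ → ℝ) (s : ℂ) :
    Landau.mellinIoi (fun x ↦ G (Real.log x)) s =
      ∫ t in Ioi (0 : ℝ), (G t : ℂ) * cexp (-s * t) := by
  unfold Landau.mellinIoi
  rw [integral_Ioi_one_eq_integral_Ioi_zero]
  refine setIntegral_congr_fun measurableSet_Ioi fun t _ ↦ ?_
  dsimp only
  rw [Real.log_exp, ofReal_exp_cpow, Complex.real_smul, Complex.ofReal_exp]
  have : cexp (t : ℂ) * cexp ((t : ℂ) * -(s + 1)) = cexp (-s * t) := by
    rw [← Complex.exp_add]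
    congr 1
    ring
  rw [← this]
  ring

/-- `G(log x) x^{-(σ+1)} ∈ L¹(1,∞)` iff `G(t) e^{-σt} ∈ L¹(0,∞)` (real `σ`). [folklore] -/
private theorem integrableOn_comp_log_iff (G : ℝ → ℝ) (σ : ℝ) :
    IntegrableOn (fun x : ℝ ↦ G (Real.log x) * x ^ (-(σ + 1))) (Ioi 1) ↔
      IntegrableOn (fun t : ℝ ↦ G t * Real.exp (-σ * t)) (Ioi 0) := by
  rw [integrableOn_Ioi_one_iff]
  refine integrableOn_congr_fun (fun t _ ↦ ?_) measurableSet_Ioi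
  rw [smul_eq_mul, Real.log_exp, Real.rpow_def_of_pos (Real.exp_pos t), Real.log_exp]
  have : Real.exp t * Real.exp (t * -(σ + 1)) = Real.exp (-σ * t) := by
    rw [← Real.exp_add]
    congr 1
    ring
  rw [← this]
  ring

/-- Complex integrability of `G(t) e^{-σt}` gives real integrability. [folklore] -/
private theorem integrableOn_exp_of_cexp {G : ℝ → ℝ} (hG : Measurable G) {σ : ℝ}
    (h : IntegrableOn (fun t : ℝ ↦ (G t : ℂ) * cexp (-(σ : ℂ) * t)) (Ioi 0)) :
    IntegrableOn (fun t : ℝ ↦ G t * Real.exp (-σ * t)) (Ioi 0) := by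
  have h' : IntegrableOn (fun t : ℝ ↦ ‖(G t : ℂ) * cexp (-(σ : ℂ) * t)‖) (Ioi 0) := h.norm
  have hmeas : AEStronglyMeasurable (fun t : ℝ ↦ G t * Real.exp (-σ * t))
      (volume.restrict (Ioi 0)) :=
    (hG.mul (Real.continuous_exp.measurable.comp (measurable_const.mul measurable_id))).aestronglyMeasurable
  refine (integrable_norm_iff hmeas).1 (h'.congr_fun (fun t _ ↦ ?_) measurableSet_Ioi)
  dsimp only
  rw [norm_mul, norm_mul, Complex.norm_real, Real.norm_eq_abs,
    ZetaScrewLaplace.norm_cexp_mul_ofReal, Real.norm_of_nonneg (Real.exp_pos _).le]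
  simp

/-- `ζ₁(1/2 + s) ≠ 0` for `Re s > 1/2` (no zeros of `ζ` on `Re w ≥ 1`, `ζ₁(1) = 1`). [folklore] -/
private theorem riemannZeta₁_half_add_ne_zero {s : ℂ} (hs : 1 / 2 ≤ s.re) :
    riemannZeta₁ (1 / 2 + s) ≠ 0 :=
  (riemannZeta₁_ne_zero_of_riemannXi (s := 1 / 2 + s) (by simp; linarith)).2

/-- `ζ₁(1/2 + σ) ≠ 0` for real `σ > 0` (`ζ < 0` on `(0,1)`, `ζ₁(1) = 1`, `ζ ≠ 0` on `[1,∞)`). [folklore] -/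
private theorem riemannZeta₁_half_add_ofReal_ne_zero {σ : ℝ} (hσ : 0 < σ) :
    riemannZeta₁ (1 / 2 + σ) ≠ 0 := by
  rcases lt_or_ge σ (1 / 2) with h | h
  · have hne : (1 / 2 : ℂ) + σ ≠ 1 := by
      intro h1
      have := congrArg Complex.re h1
      simp at this
      linarith
    rw [Ne, riemannZeta₁_eq_zero_iff hne]
    have := riemannZeta_ofReal_ne_zero_of_pos_of_lt_one (1 / 2 + σ) (by linarith) (by linarith)
    push_cast at this
    exact this
  · exact riemannZeta₁_half_add_ne_zero (s := σ) (by simpa using h)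

/-- `R(s) = (ζ₁'/ζ₁(1/2+s) + P(s))/s²` is differentiable at `s ≠ 0` with `ζ₁(1/2+s) ≠ 0` where `P` is.
[folklore] -/
private theorem differentiableAt_R {P : ℂ → ℂ} {s : ℂ} (hs0 : s ≠ 0) (hζ : riemannZeta₁ (1 / 2 + s) ≠ 0)
    (hP : DifferentiableAt ℂ P s) :
    DifferentiableAt ℂ (fun s : ℂ ↦ (logDeriv riemannZeta₁ (1 / 2 + s) + P s) / s ^ 2) s := by
  have hlog : AnalyticAt ℂ (logDeriv riemannZeta₁) (1 / 2 + s) := by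
    have h : logDeriv riemannZeta₁ = fun z ↦ deriv riemannZeta₁ z / riemannZeta₁ z := by
      funext z; rw [logDeriv_apply]
    rw [h]
    exact (differentiable_riemannZeta₁.analyticAt _).deriv.div
      (differentiable_riemannZeta₁.analyticAt _) hζ
  have hcomp : DifferentiableAt ℂ (fun s : ℂ ↦ logDeriv riemannZeta₁ (1 / 2 + s)) s :=
    hlog.differentiableAt.comp s (by fun_prop)
  exact (hcomp.add hP).div (by fun_prop) (pow_ne_zero 2 hs0)

/-- **Landau's theorem in the shape used by [Suzuki2025Chebyshev] §3.1–3.2.** Let `G : ℝ → ℝ` be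
measurable and non-negative on `(t₀, ∞)`, with `G(t)e^{-t}` integrable on `(0, ∞)`, and suppose that
for `Re S > 1` its Laplace transform is `∫_0^∞ G(t) e^{-St} dt = (ζ₁'/ζ₁(1/2 + S) + P(S))/S²` with
`P` holomorphic on `Re S > 0` (`ζ₁(w) = (w−1)ζ(w)`, so `ζ₁'/ζ₁ = ζ'/ζ + 1/(w−1)` has no pole at
`w = 1`). Then RH holds: `ζ₁'/ζ₁(1/2+S)` has no poles on the real ray `S > 0` (`ζ` has no zeros on
`(1/2, ∞)`), so by Landau's theorem (Prop. 1 of the paper; the tree's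
`Landau.integrableOn_of_differentiableOn_union_convex`) the transform converges on `Re S > 0` and is
holomorphic there, which is incompatible with a zero of `ζ₁(1/2 + ·)` of finite order in
`0 < Re S < 1/2` (`Z' = G·Z` near the zero); hence `QuasiRiemannHypothesis (1/2)`, i.e. RH.
[cite: Suzuki2025Chebyshev, §2 Prop 1 and §3.1] -/
theorem riemannHypothesis_of_laplace_eq {G : ℝ → ℝ} (hG : Measurable G) {t₀ : ℝ}
    (hpos : ∀ t : ℝ, t₀ < t → 0 ≤ G t)
    (hint : IntegrableOn (fun t : ℝ ↦ (G t : ℂ) * cexp (-(1 : ℂ) * t)) (Ioi 0))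
    {P : ℂ → ℂ} (hP : DifferentiableOn ℂ P {s : ℂ | 0 < s.re})
    (htr : ∀ s : ℂ, 1 < s.re → ∫ t in Ioi (0 : ℝ), (G t : ℂ) * cexp (-s * t) =
      (logDeriv riemannZeta₁ (1 / 2 + s) + P s) / s ^ 2) :
    RiemannHypothesis := by
  refine quasiRiemannHypothesis_one_half_iff_holds.1 fun w hw h1 h2 ↦ ?_
  -- the zero `w₀ = w - 1/2` of `Z = ζ₁(1/2 + ·)`, with `0 < Re w₀ < 1/2`
  set w₀ : ℂ := w - 1 / 2 with hw₀_def
  have hw₀ : 0 < w₀.re := by simp [hw₀_def]; linarith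
  have hw₀' : w₀.re < 1 / 2 := by simp [hw₀_def]; linarith
  have hw1 : w ≠ 1 := fun h ↦ by rw [h] at h2; simp at h2
  have hzero : riemannZeta₁ (1 / 2 + w₀) = 0 := by
    rw [show (1 / 2 : ℂ) + w₀ = w by rw [hw₀_def]; ring, riemannZeta₁_eq_zero_iff hw1]
    exact hw
  -- the Mellin data
  set g : ℝ → ℝ := fun x ↦ G (Real.log x) with hg_def
  have hg : Measurable g := hG.comp Real.measurable_log
  set R : ℂ → ℂ := fun s ↦ (logDeriv riemannZeta₁ (1 / 2 + s) + P s) / s ^ 2 with hR_def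
  set ε : ℝ := w₀.re / 2 with hε_def
  have hε : 0 < ε := by positivity
  have hε1 : ε < 1 := by rw [hε_def]; linarith
  -- a zero-free thin rectangle around the real segment `[ε/2, 3]`
  set K : Set ℂ := (fun σ : ℝ ↦ (σ : ℂ)) '' Icc (ε / 2) 3 with hK_def
  have hKc : IsCompact K := (isCompact_Icc.image Complex.continuous_ofReal)
  set U : Set ℂ := {s : ℂ | riemannZeta₁ (1 / 2 + s) ≠ 0} with hU_def
  have hUo : IsOpen U := by
    have : U = (fun s : ℂ ↦ riemannZeta₁ (1 / 2 + s)) ⁻¹' {0}ᶜ := rfl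
    rw [this]
    exact isOpen_compl_singleton.preimage
      (differentiable_riemannZeta₁.continuous.comp (by fun_prop))
  have hKU : K ⊆ U := by
    rintro _ ⟨σ, hσ, rfl⟩
    exact riemannZeta₁_half_add_ofReal_ne_zero (by linarith [hσ.1])
  obtain ⟨d₀, hd₀, hthick⟩ := hKc.exists_thickening_subset_open hUo hKU
  set W₀ : Set ℂ := {s : ℂ | ε / 2 < s.re ∧ s.re < 3 ∧ -d₀ < s.im ∧ s.im < d₀} with hW₀_def
  have hW₀eq : W₀ = {s : ℂ | ε / 2 < s.re} ∩ ({s : ℂ | s.re < 3} ∩ ({s : ℂ | -d₀ < s.im} ∩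
      {s : ℂ | s.im < d₀})) := by
    ext s; simp [hW₀_def]
  have hW₀o : IsOpen W₀ := by
    rw [hW₀eq]
    exact (isOpen_lt continuous_const Complex.continuous_re).inter
      ((isOpen_lt Complex.continuous_re continuous_const).inter
        ((isOpen_lt continuous_const Complex.continuous_im).inter
          (isOpen_lt Complex.continuous_im continuous_const)))
  have hW₀c : Convex ℝ W₀ := by
    rw [hW₀eq]
    exact (convex_halfSpace_re_gt _).inter ((convex_halfSpace_re_lt _).inter
      ((convex_halfSpace_im_gt _).inter (convex_halfSpace_im_lt _)))
  have hW₀U : W₀ ⊆ U := by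
    intro s hs
    refine hthick (Metric.mem_thickening_iff.2 ⟨(s.re : ℂ), ⟨s.re, ⟨hs.1.le, hs.2.1.le⟩, rfl⟩, ?_⟩)
    rw [dist_eq_norm]
    have : s - (s.re : ℂ) = (s.im : ℂ) * I := by
      apply Complex.ext <;> simp
    rw [this, norm_mul, Complex.norm_I, mul_one, Complex.norm_real, Real.norm_eq_abs, abs_lt]
    exact ⟨hs.2.2.1, hs.2.2.2⟩
  have hW₀r : ∀ σ : ℝ, ε < σ → σ ≤ 1 + 1 → (σ : ℂ) ∈ W₀ := by
    intro σ h1 h2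
    simp only [hW₀_def, Set.mem_setOf_eq, ofReal_re, ofReal_im, neg_lt_zero]
    exact ⟨by linarith, by linarith, hd₀, hd₀⟩
  have hopen₀ : IsOpen {s : ℂ | 0 < s.re} := isOpen_lt continuous_const Complex.continuous_re
  -- `R` is holomorphic on `{Re s > 1} ∪ W₀` and agrees with the transform on `Re s > 1`
  have hΦ : DifferentiableOn ℂ R ({s : ℂ | 1 < s.re} ∪ W₀) := by
    intro s hs
    have hre : 0 < s.re := by
      rcases hs with hs | hs
      · simp only [Set.mem_setOf_eq] at hs; linarith
      · linarith [hs.1]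
    have hs0 : s ≠ 0 := fun h0 ↦ by rw [h0, zero_re] at hre; exact lt_irrefl _ hre
    have hζ : riemannZeta₁ (1 / 2 + s) ≠ 0 := by
      rcases hs with hs | hs
      · exact riemannZeta₁_half_add_ne_zero (by simp only [Set.mem_setOf_eq] at hs; linarith)
      · exact hW₀U hs
    exact (differentiableAt_R hs0 hζ (hP.differentiableAt (hopen₀.mem_nhds hre))).differentiableWithinAt
  have hagree : EqOn R (Landau.mellinIoi g) {s : ℂ | 1 < s.re} := by
    intro s hs
    simp only [Set.mem_setOf_eq] at hs
    show R s = Landau.mellinIoi (fun x ↦ G (Real.log x)) s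
    rw [mellinIoi_comp_log, htr s hs]
  have hint' : IntegrableOn (fun x ↦ g x * x ^ (-((1 : ℝ) + 1))) (Ioi 1) := by
    show IntegrableOn (fun x ↦ G (Real.log x) * x ^ (-((1 : ℝ) + 1))) (Ioi 1)
    rw [integrableOn_comp_log_iff]
    refine integrableOn_exp_of_cexp hG (σ := 1) ?_
    simpa using hint
  set X₁ : ℝ := Real.exp (max t₀ 0) with hX₁_def
  have hX₁ : 1 ≤ X₁ := Real.one_le_exp (le_max_right _ _)
  have hpos' : ∀ x : ℝ, X₁ < x → 0 ≤ g x := by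
    intro x hx
    have hx0 : 0 < x := lt_trans (Real.exp_pos _) hx
    refine hpos _ (lt_of_le_of_lt (le_max_left t₀ 0) ?_)
    rw [← Real.log_exp (max t₀ 0)]
    exact Real.log_lt_log (Real.exp_pos _) hx
  -- Landau: absolute convergence for every `σ > ε`, holomorphy of `F` on `Re s > ε`
  have hS : ∀ σ' : ℝ, ε < σ' → IntegrableOn (fun x ↦ g x * x ^ (-(σ' + 1))) (Ioi 1) :=
    fun σ' hσ' ↦ Landau.integrableOn_of_differentiableOn_union_convex hg hint' hX₁ hpos'
      hε1 hW₀o hW₀c hW₀r hΦ hagree hσ'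
  set F : ℂ → ℂ := Landau.mellinIoi g with hF_def
  have hFdiff : DifferentiableOn ℂ F {s : ℂ | ε < s.re} :=
    Landau.differentiableOn_mellinIoi_of_forall hg hS
  set H : Set ℂ := {s : ℂ | ε < s.re} with hH_def
  have hHo : IsOpen H := isOpen_lt continuous_const Complex.continuous_re
  have hHpre : IsPreconnected H := (convex_halfSpace_re_gt ε).isPreconnected
  have hH₀ : H ⊆ {s : ℂ | 0 < s.re} := fun s hs ↦ by
    simp only [hH_def, Set.mem_setOf_eq] at hs ⊢; linarith
  -- the identity `(F(s) s² − P(s)) ζ₁(1/2+s) = ζ₁'(1/2+s)` on `H`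
  set Z : ℂ → ℂ := fun s ↦ riemannZeta₁ (1 / 2 + s) with hZ_def
  have hZd : Differentiable ℂ Z := differentiable_riemannZeta₁.comp (by fun_prop)
  have hZa : ∀ s, AnalyticAt ℂ Z s := fun s ↦ hZd.analyticAt s
  have hderivZ : ∀ s, deriv Z s = deriv riemannZeta₁ (1 / 2 + s) := fun s ↦ by
    simp only [hZ_def]
    exact deriv_comp_const_add riemannZeta₁ (1 / 2) s
  set G₁ : ℂ → ℂ := fun s ↦ F s * s ^ 2 - P s with hG₁_def
  have hGa : ∀ s ∈ H, AnalyticAt ℂ G₁ s := fun s hs ↦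
    (((hFdiff.analyticOnNhd hHo) s hs).mul (analyticAt_id.pow 2)).sub
      (hP.analyticAt (hopen₀.mem_nhds (hH₀ hs)))
  have hf₁ : AnalyticOnNhd ℂ (G₁ * Z) H := fun s hs ↦ (hGa s hs).mul (hZa s)
  have hf₂ : AnalyticOnNhd ℂ (deriv Z) H := fun s _ ↦ (hZa s).deriv
  have h2H : (2 : ℂ) ∈ H := by simp [hH_def]; linarith
  have hev2 : (G₁ * Z) =ᶠ[𝓝 (2 : ℂ)] deriv Z := by
    have hopen : IsOpen {s : ℂ | 1 < s.re} := isOpen_lt continuous_const Complex.continuous_re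
    filter_upwards [hopen.mem_nhds (show (2 : ℂ) ∈ {s : ℂ | 1 < s.re} by simp)] with s hs
    have hs' : 1 < s.re := hs
    have hζ : riemannZeta₁ (1 / 2 + s) ≠ 0 := riemannZeta₁_half_add_ne_zero (by linarith)
    have hs0 : s ≠ 0 := fun h ↦ by rw [h, zero_re] at hs'; linarith
    rw [Pi.mul_apply, hderivZ s]
    simp only [hG₁_def, hZ_def]
    rw [← hagree hs]
    simp only [hR_def]
    rw [logDeriv_apply]
    set A : ℂ := deriv riemannZeta₁ (1 / 2 + s)
    set B : ℂ := riemannZeta₁ (1 / 2 + s)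
    field_simp
    ring
  have hEqOn : EqOn (G₁ * Z) (deriv Z) H :=
    hf₁.eqOn_of_preconnected_of_eventuallyEq hf₂ hHpre h2H hev2
  -- orders at `w₀`
  have hw₀H : w₀ ∈ H := by simp [hH_def, hε_def]; linarith
  have hev : deriv Z =ᶠ[𝓝 w₀] G₁ * Z := by
    filter_upwards [hHo.mem_nhds hw₀H] with s hs
    exact (hEqOn hs).symm
  have hZ0 : Z w₀ = 0 := hzero
  have h1 : analyticOrderAt (deriv Z) w₀ + 1 = analyticOrderAt Z w₀ := by
    have := (hZa w₀).analyticOrderAt_deriv_add_one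
    simpa [hZ0] using this
  have h2 : analyticOrderAt (deriv Z) w₀ = analyticOrderAt G₁ w₀ + analyticOrderAt Z w₀ := by
    rw [analyticOrderAt_congr hev, analyticOrderAt_mul (hGa w₀ hw₀H) (hZa w₀)]
  rw [h2] at h1
  -- `Z` is not locally zero (`ζ₁(1) = 1`), so its order is finite: contradiction
  generalize hoZ : analyticOrderAt Z w₀ = oZ at h1
  generalize hoG : analyticOrderAt G₁ w₀ = oG at h1
  cases oZ with
  | top =>
    have hloc : ∀ᶠ s in 𝓝 w₀, Z s = 0 := analyticOrderAt_eq_top.1 hoZ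
    have hall : EqOn Z 0 univ :=
      (hZd.differentiableOn.analyticOnNhd isOpen_univ).eqOn_zero_of_preconnected_of_eventuallyEq_zero
        isPreconnected_univ (Set.mem_univ w₀) hloc
    have h1' : Z (1 / 2) = 0 := hall (Set.mem_univ _)
    simp only [hZ_def] at h1'
    rw [show (1 / 2 : ℂ) + 1 / 2 = 1 by norm_num, riemannZeta₁_one] at h1'
    exact one_ne_zero h1'
  | coe n =>
    cases oG with
    | top => simp at h1
    | coe m =>
      have h' : (m + n + 1 : ℕ) = n := by exact_mod_cast h1
      omega

/-! ### The two Laplace transforms ((3.4)–(3.5) of the paper) -/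

/-- **(3.5)** in the variable `a = −S`: for `Re a < −1/2`, `t ↦ (−g_0(t)) e^{at}` is integrable on
`(0,∞)` and `∫_0^∞ (−g_0(t)) e^{at} dt = 4(−1/(a+½) − 1/(a−½) + 2/a) − a^{-2} Σ_n Λ(n) n^{-(1/2−a)}`.
[cite: Suzuki2025Chebyshev, §3.2 eq. (3.5)] -/
theorem integral_zetaScrewNonArch_mul_cexp {a : ℂ} (ha : a.re < -1 / 2) :
    IntegrableOn (fun t : ℝ ↦ (zetaScrewNonArch t : ℂ) * cexp (a * t)) (Ioi 0) ∧
      ∫ t in Ioi (0 : ℝ), (zetaScrewNonArch t : ℂ) * cexp (a * t) =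
        4 * (-1 / (a + 1 / 2) + -1 / (a - 1 / 2) - 2 * (-1 / a))
          - 1 / a ^ 2 * L ↗Λ (1 / 2 - a) := by
  have ha' : a.re < 0 := by linarith
  -- the parts
  set f₁ : ℝ → ℂ := fun t ↦ 4 * ((Real.exp (t / 2) : ℂ) * cexp (a * t)
      + (Real.exp (-(t / 2)) : ℂ) * cexp (a * t) - 2 * cexp (a * t)) with hf₁
  set f₂ : ℝ → ℂ := fun t ↦ (zetaScrewPrimeSum t : ℂ) * cexp (a * t) with hf₂
  have heq : EqOn (fun t : ℝ ↦ (zetaScrewNonArch t : ℂ) * cexp (a * t))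
      (fun t ↦ f₁ t - f₂ t) (Ioi 0) := by
    intro t _
    simp only [hf₁, hf₂, zetaScrewNonArch_eq]
    push_cast
    ring
  have h1a : IntegrableOn (fun t : ℝ ↦ (Real.exp (t / 2) : ℂ) * cexp (a * t)) (Ioi 0) := by
    have h := ZetaScrewLaplace.integrableOn_exp_mul_cexp (a := a) (c := 1 / 2) (by linarith)
    refine h.congr_fun (fun t _ ↦ ?_) measurableSet_Ioi
    dsimp only
    rw [show (1 / 2 : ℝ) * t = t / 2 by ring]
  have h1b : IntegrableOn (fun t : ℝ ↦ (Real.exp (-(t / 2)) : ℂ) * cexp (a * t)) (Ioi 0) := by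
    have h := ZetaScrewLaplace.integrableOn_exp_mul_cexp (a := a) (c := -(1 / 2)) (by linarith)
    refine h.congr_fun (fun t _ ↦ ?_) measurableSet_Ioi
    dsimp only
    rw [show (-(1 / 2) : ℝ) * t = -(t / 2) by ring]
  have h1c : IntegrableOn (fun t : ℝ ↦ cexp (a * t)) (Ioi 0) :=
    integrableOn_exp_mul_complex_Ioi ha' 0
  have h1ab : IntegrableOn (fun t : ℝ ↦ (Real.exp (t / 2) : ℂ) * cexp (a * t)
      + (Real.exp (-(t / 2)) : ℂ) * cexp (a * t)) (Ioi 0) := h1a.add h1b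
  have h1c2 : IntegrableOn (fun t : ℝ ↦ 2 * cexp (a * t)) (Ioi 0) := h1c.const_mul 2
  have h1abc : IntegrableOn (fun t : ℝ ↦ (Real.exp (t / 2) : ℂ) * cexp (a * t)
      + (Real.exp (-(t / 2)) : ℂ) * cexp (a * t) - 2 * cexp (a * t)) (Ioi 0) := h1ab.sub h1c2
  have hi₁ : IntegrableOn f₁ (Ioi 0) := h1abc.const_mul 4
  obtain ⟨hi₂, hI₂⟩ := ZetaScrewLaplace.integral_primeSum_mul_cexp ha
  have hi₁₂ : IntegrableOn (fun t ↦ f₁ t - f₂ t) (Ioi 0) := hi₁.sub hi₂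
  refine ⟨hi₁₂.congr_fun heq.symm measurableSet_Ioi, ?_⟩
  have hI₁ : ∫ t in Ioi (0 : ℝ), f₁ t =
      4 * (-1 / (a + 1 / 2) + -1 / (a - 1 / 2) - 2 * (-1 / a)) := by
    simp only [hf₁]
    rw [integral_const_mul, integral_sub h1ab h1c2, integral_add h1a h1b, integral_const_mul,
      ZetaScrewLaplace.integral_exp_half_mul_cexp ha,
      ZetaScrewLaplace.integral_exp_neg_half_mul_cexp (by linarith),
      ZetaScrewLaplace.integral_cexp ha']
  rw [setIntegral_congr_fun measurableSet_Ioi heq, integral_sub hi₁ hi₂, hI₁, hI₂]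

/-- **(3.4)** in the variable `a = −S`: for `Re a < −1/2`, `t ↦ (4e^{t/2} − φ(t)) e^{at}` is integrable
on `(0,∞)` and `∫_0^∞ (4e^{t/2} − φ(t)) e^{at} dt = −4/(a+½) − a^{-2} Σ_n Λ(n) n^{-(1/2−a)}`
(`x = e^t` in `∫_1^∞ (4√x − f(x)) x^{-s+1/2} dx/x`). [cite: Suzuki2025Chebyshev, §3.1 eq. (3.4)] -/
theorem integral_exp_sub_primeSum_mul_cexp {a : ℂ} (ha : a.re < -1 / 2) :
    IntegrableOn (fun t : ℝ ↦ ((4 * Real.exp (t / 2) - zetaScrewPrimeSum t : ℝ) : ℂ) * cexp (a * t))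
        (Ioi 0) ∧
      ∫ t in Ioi (0 : ℝ), ((4 * Real.exp (t / 2) - zetaScrewPrimeSum t : ℝ) : ℂ) * cexp (a * t) =
        4 * (-1 / (a + 1 / 2)) - 1 / a ^ 2 * L ↗Λ (1 / 2 - a) := by
  set f₁ : ℝ → ℂ := fun t ↦ 4 * ((Real.exp (t / 2) : ℂ) * cexp (a * t)) with hf₁
  set f₂ : ℝ → ℂ := fun t ↦ (zetaScrewPrimeSum t : ℂ) * cexp (a * t) with hf₂
  have heq : EqOn (fun t : ℝ ↦ ((4 * Real.exp (t / 2) - zetaScrewPrimeSum t : ℝ) : ℂ) * cexp (a * t))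
      (fun t ↦ f₁ t - f₂ t) (Ioi 0) := by
    intro t _
    simp only [hf₁, hf₂]
    push_cast
    ring
  have h1a : IntegrableOn (fun t : ℝ ↦ (Real.exp (t / 2) : ℂ) * cexp (a * t)) (Ioi 0) := by
    have h := ZetaScrewLaplace.integrableOn_exp_mul_cexp (a := a) (c := 1 / 2) (by linarith)
    refine h.congr_fun (fun t _ ↦ ?_) measurableSet_Ioi
    dsimp only
    rw [show (1 / 2 : ℝ) * t = t / 2 by ring]
  have hi₁ : IntegrableOn f₁ (Ioi 0) := h1a.const_mul 4
  obtain ⟨hi₂, hI₂⟩ := ZetaScrewLaplace.integral_primeSum_mul_cexp ha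
  have hi₁₂ : IntegrableOn (fun t ↦ f₁ t - f₂ t) (Ioi 0) := hi₁.sub hi₂
  refine ⟨hi₁₂.congr_fun heq.symm measurableSet_Ioi, ?_⟩
  have hI₁ : ∫ t in Ioi (0 : ℝ), f₁ t = 4 * (-1 / (a + 1 / 2)) := by
    simp only [hf₁]
    rw [integral_const_mul, ZetaScrewLaplace.integral_exp_half_mul_cexp ha]
  rw [setIntegral_congr_fun measurableSet_Ioi heq, integral_sub hi₁ hi₂, hI₁, hI₂]

/-- (3.5) in the Landau variable: for `Re S > 1`,
`∫_0^∞ (−g_0(t)) e^{−St} dt = (ζ₁'/ζ₁(1/2+S) + 1/(S+1/2))/S²`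
(`= S^{-2}(ζ'/ζ(1/2+S) + 1/(S−1/2) + 1/(S+1/2))`). [cite: Suzuki2025Chebyshev, §3.2 eq. (3.5)] -/
theorem laplace_zetaScrewNonArch {s : ℂ} (hs : 1 < s.re) :
    ∫ t in Ioi (0 : ℝ), (zetaScrewNonArch t : ℂ) * cexp (-s * t) =
      (logDeriv riemannZeta₁ (1 / 2 + s) + 1 / (s + 1 / 2)) / s ^ 2 := by
  have ha : (-s).re < -1 / 2 := by simp; linarith
  rw [(integral_zetaScrewNonArch_mul_cexp ha).2, show (1 / 2 : ℂ) - -s = 1 / 2 + s by ring]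
  have hL : L ↗Λ (1 / 2 + s) = 1 / (1 / 2 + s - 1) - logDeriv riemannZeta₁ (1 / 2 + s) := by
    have := logDeriv_riemannZeta₁_eq_of_one_lt_re (s := 1 / 2 + s) (by simp; linarith)
    rw [this]
    ring
  rw [hL]
  have hs0 : s ≠ 0 := fun h ↦ by rw [h, zero_re] at hs; linarith
  have hp : s + 1 / 2 ≠ 0 := by
    intro h
    have := congrArg Complex.re h
    simp at this
    linarith
  have hq : s - 1 / 2 ≠ 0 := by
    intro h
    have := congrArg Complex.re h
    simp at this
    linarith
  have hp2 : (2 * s + 1 : ℂ) ≠ 0 := by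
    intro h; apply hp; linear_combination h / 2
  have hq2 : (2 * s - 1 : ℂ) ≠ 0 := by
    intro h; apply hq; linear_combination h / 2
  set LD := logDeriv riemannZeta₁ (1 / 2 + s)
  have e1 : (-s + 1 / 2 : ℂ) = -((2 * s - 1) / 2) := by ring
  have e2 : (-s - 1 / 2 : ℂ) = -((2 * s + 1) / 2) := by ring
  have e3 : (1 / 2 + s - 1 : ℂ) = (2 * s - 1) / 2 := by ring
  have e4 : (s + 1 / 2 : ℂ) = (2 * s + 1) / 2 := by ring
  rw [e1, e2, e3, e4]
  field_simp
  ring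

/-- (3.4) in the Landau variable: for `Re S > 1`,
`∫_0^∞ (4e^{t/2} − φ(t)) e^{−St} dt = (ζ₁'/ζ₁(1/2+S) + 4S + 2)/S²` (`= S^{-2}ζ'/ζ(1/2+S) + 4/(S−1/2)`).
[cite: Suzuki2025Chebyshev, §3.1 eq. (3.4)] -/
theorem laplace_exp_sub_primeSum {s : ℂ} (hs : 1 < s.re) :
    ∫ t in Ioi (0 : ℝ), ((4 * Real.exp (t / 2) - zetaScrewPrimeSum t : ℝ) : ℂ) * cexp (-s * t) =
      (logDeriv riemannZeta₁ (1 / 2 + s) + (4 * s + 2)) / s ^ 2 := by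
  have ha : (-s).re < -1 / 2 := by simp; linarith
  rw [(integral_exp_sub_primeSum_mul_cexp ha).2, show (1 / 2 : ℂ) - -s = 1 / 2 + s by ring]
  have hL : L ↗Λ (1 / 2 + s) = 1 / (1 / 2 + s - 1) - logDeriv riemannZeta₁ (1 / 2 + s) := by
    have := logDeriv_riemannZeta₁_eq_of_one_lt_re (s := 1 / 2 + s) (by simp; linarith)
    rw [this]
    ring
  rw [hL]
  have hs0 : s ≠ 0 := fun h ↦ by rw [h, zero_re] at hs; linarith
  have hq : s - 1 / 2 ≠ 0 := by
    intro h
    have := congrArg Complex.re h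
    simp at this
    linarith
  have hq2 : (2 * s - 1 : ℂ) ≠ 0 := by
    intro h; apply hq; linear_combination h / 2
  set LD := logDeriv riemannZeta₁ (1 / 2 + s)
  have e1 : (-s + 1 / 2 : ℂ) = -((2 * s - 1) / 2) := by ring
  have e3 : (1 / 2 + s - 1 : ℂ) = (2 * s - 1) / 2 := by ring
  rw [e1, e3]
  field_simp
  ring

end ZetaScrewNonArchSign

/-! ## Corollary 1 and Theorem 1 -/

/-- **«−g_0(t) ≥ 0 for all t ≥ t₀» ⇒ RH** (the converse half of Cor. 1, §3.2: Landau's theorem applied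
to (3.5)). [cite: Suzuki2025Chebyshev, Cor 1 (proof, §3.2)] -/
theorem riemannHypothesis_of_zetaScrewNonArch_nonneg {t₀ : ℝ}
    (h : ∀ t : ℝ, t₀ ≤ t → 0 ≤ zetaScrewNonArch t) : RiemannHypothesis := by
  refine ZetaScrewNonArchSign.riemannHypothesis_of_laplace_eq (G := zetaScrewNonArch)
    continuous_zetaScrewNonArch.measurable (t₀ := t₀) (fun t ht ↦ h t ht.le) ?_
    (P := fun s ↦ 1 / (s + 1 / 2)) ?_ fun s hs ↦ ZetaScrewNonArchSign.laplace_zetaScrewNonArch hs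
  · have := (ZetaScrewNonArchSign.integral_zetaScrewNonArch_mul_cexp (a := -1) (by norm_num)).1
    simpa using this
  · intro s hs
    have hne : s + 1 / 2 ≠ 0 := by
      intro h0
      have := congrArg Complex.re h0
      simp only [Set.mem_setOf_eq] at hs
      simp at this
      linarith
    refine DifferentiableAt.differentiableWithinAt ?_
    exact (differentiableAt_const (1 : ℂ)).div (differentiableAt_id.add_const _) hne

/-- **Suzuki 2025, Corollary 1** (AS PRINTED): «the RH holds if and only if there exists `t_0 > 0`
such that `−g_0(t) ≥ 0` holds for all `t ≥ t_0`», `−g_0 = zetaScrewNonArch`. RH-EQUIVALENT criterion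
on the finite prime sums `Σ_{n ≤ e^t} Λ(n) n^{-1/2}(t − log n)` against `4(e^{t/2} + e^{−t/2} − 2)`.
[cite: Suzuki2025Chebyshev, Cor 1] -/
theorem Suzuki2025_cor1 :
    RiemannHypothesis ↔ ∃ t₀ : ℝ, 0 < t₀ ∧ ∀ t : ℝ, t₀ ≤ t → 0 ≤ zetaScrewNonArch t := by
  constructor
  · intro hRH
    set κ := Real.eulerMascheroniConstant + Real.pi / 2 + 3 * Real.log 2 + Real.log Real.pi
    set C := ∑' k : ℕ, 1 / ((k : ℝ) + 1 / 4) ^ 2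
    have hκ : 0 < κ := screwKappa_pos
    have hC : 0 ≤ C := screwC_nonneg
    refine ⟨C / (2 * κ) + 1, by positivity, fun t ht ↦ zetaScrewNonArch_nonneg_of_RH hRH ?_⟩
    have ht0 : 0 ≤ t := by
      have : 0 ≤ C / (2 * κ) := by positivity
      linarith
    rw [abs_of_nonneg ht0]
    linarith
  · rintro ⟨t₀, -, h⟩
    exact riemannHypothesis_of_zetaScrewNonArch_nonneg h

/-- **Suzuki 2025, Theorem 1, (i) ⇔ (ii)** (AS PRINTED, the sum over `1 ≤ n ≤ ⌊x⌋`): RH holds iff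
«there exists an `x₀ ≥ 2` such that `Σ_{n ≤ x} Λ(n) n^{-1/2} log(x/n) − 4√x ≤ 0` holds for all
`x ≥ x₀`» (the left-hand side is `∫_0^x (ψ_{1/2}(y) − 2√y) dy/y`, (1.5)). (ii) ⇒ (i): Landau's theorem
on (3.4) (§3.1); (i) ⇒ (ii): here via `Ψ ≥ 0` under RH and (1.9) (`f(x) − 4√x = 4/√x − 8 + g_0(log x)`),
in place of the explicit formula (3.1). Clause (iii) is not formalised (see the module docstring).
RH-EQUIVALENT criterion. [cite: Suzuki2025Chebyshev, Thm 1] -/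
theorem Suzuki2025_thm1 :
    RiemannHypothesis ↔ ∃ x₀ : ℝ, 2 ≤ x₀ ∧ ∀ x : ℝ, x₀ ≤ x →
      ∑ n ∈ Finset.Icc 1 ⌊x⌋₊, Λ n / Real.sqrt n * Real.log (x / n) - 4 * Real.sqrt x ≤ 0 := by
  constructor
  · intro hRH
    set κ := Real.eulerMascheroniConstant + Real.pi / 2 + 3 * Real.log 2 + Real.log Real.pi
    set C := ∑' k : ℕ, 1 / ((k : ℝ) + 1 / 4) ^ 2
    have hκ : 0 < κ := screwKappa_pos
    have hC : 0 ≤ C := screwC_nonneg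
    refine ⟨max 2 (Real.exp (C / (2 * κ))), le_max_left _ _, fun x hx ↦ ?_⟩
    have hx2 : 2 ≤ x := le_trans (le_max_left _ _) hx
    have hx1 : 1 ≤ x := by linarith
    have hx0 : 0 < x := by linarith
    have hlog : C / (2 * κ) ≤ |Real.log x| := by
      rw [abs_of_nonneg (Real.log_nonneg hx1), ← Real.log_exp (C / (2 * κ))]
      exact Real.log_le_log (Real.exp_pos _) (le_trans (le_max_right _ _) hx)
    have hnn := zetaScrewNonArch_nonneg_of_RH hRH hlog
    rw [zetaScrewNonArch_log hx1] at hnn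
    have hsqrt : 1 ≤ Real.sqrt x := by
      rw [show (1 : ℝ) = Real.sqrt 1 by simp]
      exact Real.sqrt_le_sqrt hx1
    have hinv : 1 / Real.sqrt x ≤ 1 := by
      rw [div_le_one (by linarith)]
      exact hsqrt
    linarith
  · rintro ⟨x₀, hx₀, h⟩
    have hGc : Continuous fun t : ℝ ↦ 4 * Real.exp (t / 2) - zetaScrewPrimeSum t :=
      (continuous_const.mul (Real.continuous_exp.comp (continuous_id.div_const _))).sub
        continuous_zetaScrewPrimeSum
    refine ZetaScrewNonArchSign.riemannHypothesis_of_laplace_eq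
      (G := fun t ↦ 4 * Real.exp (t / 2) - zetaScrewPrimeSum t) hGc.measurable
      (t₀ := Real.log x₀) (fun t ht ↦ ?_) ?_ (P := fun s ↦ 4 * s + 2) (by fun_prop)
      fun s hs ↦ ZetaScrewNonArchSign.laplace_exp_sub_primeSum hs
    · -- non-negativity beyond `log x₀`, from (ii) at `x = e^t`
      have hx₀0 : 0 < x₀ := by linarith
      have hxt : x₀ ≤ Real.exp t := by
        rw [← Real.exp_log hx₀0]
        exact Real.exp_le_exp.2 ht.le
      have h1 : 1 ≤ Real.exp t := le_trans (by linarith) hxt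
      have := h (Real.exp t) hxt
      rw [← zetaScrewPrimeSum_log h1, Real.log_exp, ← Real.exp_half] at this
      linarith
    · have := (ZetaScrewNonArchSign.integral_exp_sub_primeSum_mul_cexp (a := -1) (by norm_num)).1
      simpa using this

/-! ### Clause (iii): the value `(ζ'/ζ)(1/2)` and «(iii) ⇒ (i)» -/

/-- **(3.2)**: `(ζ'/ζ)(1/2) = ½(π/2 + log 8π + γ)` (`= 2.68609… > 0`), from `(ξ'/ξ)(1/2) = 0`,
`ξ'/ξ = 1/s + Γ_ℝ'/Γ_ℝ + ζ₁'/ζ₁`, `Γ_ℝ'/Γ_ℝ(s) = −½ log π + ½ψ(s/2)` and Gauss'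
`ψ(1/4) = −γ − π/2 − 3 log 2`. [cite: Suzuki2025Chebyshev, §3.1 eq. (3.2)] -/
theorem logDeriv_riemannZeta_one_half :
    logDeriv riemannZeta (1 / 2) =
      (((Real.eulerMascheroniConstant + Real.pi / 2 + 3 * Real.log 2 + Real.log Real.pi) / 2 : ℝ) : ℂ) := by
  have hζ : riemannZeta (1 / 2) ≠ 0 := by
    have := riemannZeta_ofReal_ne_zero_of_pos_of_lt_one (1 / 2) (by norm_num) (by norm_num)
    push_cast at this
    exact this
  have h1ne : (1 / 2 : ℂ) ≠ 1 := by norm_num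
  have hζ₁ : riemannZeta₁ (1 / 2) ≠ 0 := by
    rw [Ne, riemannZeta₁_eq_zero_iff h1ne]
    exact hζ
  -- `ξ'/ξ(1/2) = 0` by the functional equation
  have hξ : logDeriv riemannXi (1 / 2) = 0 := by
    have h := logDeriv_riemannXi_one_sub (1 / 2 : ℂ)
    rw [show (1 : ℂ) - 1 / 2 = 1 / 2 by norm_num] at h
    linear_combination h / 2
  have h1 := logDeriv_riemannXi_eq (s := 1 / 2) (by norm_num) hζ₁
  have hpole : ∀ m : ℕ, (1 / 2 : ℂ) / 2 ≠ -m := by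
    intro m h
    have := congrArg Complex.re h
    simp at this
    linarith [(m.cast_nonneg : (0 : ℝ) ≤ m)]
  have h2 := logDeriv_Gammaℝ hpole
  rw [show (1 / 2 : ℂ) / 2 = 1 / 4 by norm_num,
    Literature.Analysis.SpecialFunctions.Complex.digamma_one_quarter_eq_neg_ofReal,
    ← Complex.ofReal_log Real.pi_pos.le] at h2
  have h4 := logDeriv_riemannZeta_eq h1ne hζ
  rw [h4, show logDeriv riemannZeta₁ (1 / 2) = -(1 / (1 / 2)) - logDeriv Gammaℝ (1 / 2) by
    linear_combination hξ - h1, h2]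
  push_cast
  ring

/-- **Suzuki 2025, Theorem 1, (iii) ⇒ (i)**: if
`Σ_{n ≤ x} Λ(n) n^{-1/2}(1 − log n/log x) − 4√x/log x → −(ζ'/ζ)(1/2)` (`x → ∞`), then RH holds —
«By (3.2), equality (1.6) implies that (1.5) holds for all sufficiently large `x`» (then (ii) ⇒ (i)).
The limit value is written as the real number `−½(γ + π/2 + 3 log 2 + log π) = −(ζ'/ζ)(1/2)`
(`logDeriv_riemannZeta_one_half`). The converse «(i) ⇒ (iii)» (explicit formula (3.1)) is not
formalised. [cite: Suzuki2025Chebyshev, Thm 1] -/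
theorem Suzuki2025_thm1_iii_imp
    (h : Tendsto (fun x : ℝ ↦ ∑ n ∈ Finset.Icc 1 ⌊x⌋₊, Λ n / Real.sqrt n * (1 - Real.log n / Real.log x)
        - 4 * Real.sqrt x / Real.log x) atTop
      (𝓝 (-((Real.eulerMascheroniConstant + Real.pi / 2 + 3 * Real.log 2 + Real.log Real.pi) / 2)))) :
    RiemannHypothesis := by
  set κ := Real.eulerMascheroniConstant + Real.pi / 2 + 3 * Real.log 2 + Real.log Real.pi
  have hκ : 0 < κ := screwKappa_pos
  have hneg : -(κ / 2) < 0 := by linarith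
  have hev := h.eventually (Iio_mem_nhds hneg)
  obtain ⟨x₁, hx₁⟩ := eventually_atTop.1 hev
  refine Suzuki2025_thm1.2 ⟨max 2 x₁, le_max_left _ _, fun x hx ↦ ?_⟩
  have hx2 : 2 ≤ x := le_trans (le_max_left _ _) hx
  have hx0 : 0 < x := by linarith
  have hlog : 0 < Real.log x := Real.log_pos (by linarith)
  have hlt : ∑ n ∈ Finset.Icc 1 ⌊x⌋₊, Λ n / Real.sqrt n * (1 - Real.log n / Real.log x)
      - 4 * Real.sqrt x / Real.log x < 0 := hx₁ x (le_trans (le_max_right _ _) hx)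
  -- multiply by `log x > 0`
  have hmul := mul_neg_of_neg_of_pos hlt hlog
  have hsum : (∑ n ∈ Finset.Icc 1 ⌊x⌋₊, Λ n / Real.sqrt n * (1 - Real.log n / Real.log x)
      - 4 * Real.sqrt x / Real.log x) * Real.log x =
      ∑ n ∈ Finset.Icc 1 ⌊x⌋₊, Λ n / Real.sqrt n * Real.log (x / n) - 4 * Real.sqrt x := by
    rw [sub_mul, Finset.sum_mul, div_mul_cancel₀ _ hlog.ne']
    congr 1
    refine Finset.sum_congr rfl fun n hn ↦ ?_
    have hn1 : 1 ≤ n := (Finset.mem_Icc.1 hn).1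
    rw [Real.log_div hx0.ne' (by exact_mod_cast (show n ≠ 0 by omega))]
    field_simp
  rw [hsum] at hmul
  exact hmul.le

end Literature.NumberTheory.LFunctions

end
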